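import Mathlib
import Summits.Ventures.HodgeRepro.Tier4.Line4.ArchBallProduct
import Summits.Ventures.HodgeRepro.Tier4.Line4.DefiniteCompactRow

/-!
# Tier4/Line4/ArchBallSeesaw — display (8)'s archimedean input at LINE L4's seesaw plane: `ArchBallGrowth` of
`(mixedRow q (a 0) (a 2)).withTransportedTorus g g' hgg' hg'g hgΩ` over `k = E⁺` from the slice ball growth at `w₀` and the
displayed definiteness off `w₀`

Blind re-derivation cell `pub-hodge-repro`, Tier 4 «prove the step» (README §9–§10), seat t4-L1-p2 (prover, LINE L1, gen 5;
L4 service, plan-4 g6 S15640: «THEN the (8) instance at the seesaw plane `archBallGrowth_seesaw_of_hdef_of_slice : hdef →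
SliceBallGrowth (seesawPlane …) (w₀ d) ν → ArchBallGrowth (seesawPlane …) μinf`»).  Tree path
`lean/Summits/Ventures/HodgeRepro/Tier4/Line4/ArchBallSeesaw.lean`.  Mathlib-level; no literature.

THE SEAM.  The skeleton's `seesawPlane q a g g' hgg' hg'g hgΩ` is `(PlaneData.mixedRow q (a 0) (a 2)).withTransportedTorus g g'
hgg' hg'g hgΩ` by `rfl` (the (R3) seam of crit-1 Entry 190, the same shape ArchMatchingSeesaw p709235 binds); the place `w₀ d` is
`InfinitePlace.mk φ` for the real embedding `φ = d.τ₀.comp (algebraMap (kOf E) E)` of `k = ↥(maximalRealSubfield E)`; every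
infinite place of `k` is real (`IsTotallyReal.isReal`, Mathlib's `isTotallyReal_maximalRealSubfield`).

THE STATEMENTS (every declaration sorry-free, axioms `[propext, Classical.choice, Quot.sound]`).
* **`archBallGrowth_seesaw_of_hdef_of_slice`** — over `k = E⁺`, `w₀ = InfinitePlace.mk φ`: from `hcm : ∀ w, IsCMAt q w`, the
  sign clause `hdef` of the seesaw plane's OWN lines `a 0`, `a 2` at every `w′ ≠ w₀`, a Haar family `ν` on the slices and
  `hslice : SliceBallGrowth (seesawPlane) w₀ (ν w₀)`, the conclusion `ArchBallGrowth (seesawPlane) μinf` for every Haar `μinf` —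
  `archBallGrowth_of_slice` (ArchBallProduct p709699) with `hcpt := hcpt_mixedRow_of_hdef` (DefiniteCompactRow).
* **`archBallGrowth_seesaw_of_iso_of_slice`** — the same conclusion from (7a)'s DISPLAYED binders verbatim
  (ArchMatchingSeesaw's `lam`, `_hlam`, `_hiso`, `hcm`, `hdef` on `(a 1, a 3)`): definiteness moves across the seesaw isometry
  (`hcpt_withTransportedTorus_of_iso`), so (8) needs NO sign clause of its own beyond (7a)'s.
* `archBallGrowth_withTransportedTorus_of_hdef_of_slice` / `…_of_iso_of_slice` — the general-field forms (a reality binder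
  `hreal` in place of `IsTotallyReal`), from which the `E⁺` forms are the instances.

Nothing here says anything about the status of the Hodge conjecture for CM abelian varieties, which is NOT proved
(HC_CM is NOT proved by anyone in this repository).
-/

set_option autoImplicit false

noncomputable section

namespace Summit.Ventures.HodgeRepro.Tier4.Line4

open Summit.Ventures.HodgeRepro.Tier4 Summit.Ventures.HodgeRepro.Tier4.Common Summit.Ventures.HodgeRepro.Tier4.Line1
  MeasureTheory NumberField Matrix

/-! ## Part A — general field, reality off `w₀` as a binder -/

section General

variable {k : Type} [Field k] [NumberField k] (q : QuadData k) (a : Fin 4 → k)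
  (g g' : Matrix (Fin 4) (Fin 4) k) (hgg' : g * g' = 1) (hg'g : g' * g = 1)
  (hgΩ : g * (PlaneData.mixedRow q (a 0) (a 2)).Ω = (PlaneData.mixedRow q (a 0) (a 2)).Ω * g)
  [MeasurableSpace (GA ((PlaneData.mixedRow q (a 0) (a 2)).withTransportedTorus g g' hgg' hg'g hgΩ))]
  [BorelSpace (GA ((PlaneData.mixedRow q (a 0) (a 2)).withTransportedTorus g g' hgg' hg'g hgΩ))]

/-- **`ArchBallGrowth` of the transported mixed row plane from the slice bound at `w₀`**, the other places real, CM and with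
the sign clause on the plane's own lines `a 0`, `a 2`. -/
theorem archBallGrowth_withTransportedTorus_of_hdef_of_slice (w₀ : InfinitePlace k)
    (hreal : ∀ w : InfinitePlace k, w ≠ w₀ → w.IsReal) (hcm : ∀ w : InfinitePlace k, IsCMAt q w)
    (hdef : ∀ w' : InfinitePlace k, w' ≠ w₀ →
      0 < (adToC w' (algebraMap k (Ad k) (a 0))).re * (adToC w' (algebraMap k (Ad k) (-1 * a 2))).re)
    (μinf : Measure (infinitePart ((PlaneData.mixedRow q (a 0) (a 2)).withTransportedTorus g g' hgg' hg'g hgΩ)))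
    [μinf.IsHaarMeasure]
    (ν : ∀ w : InfinitePlace k,
      Measure (atPlace ((PlaneData.mixedRow q (a 0) (a 2)).withTransportedTorus g g' hgg' hg'g hgΩ) w))
    [∀ w, (ν w).IsHaarMeasure]
    (hslice : SliceBallGrowth ((PlaneData.mixedRow q (a 0) (a 2)).withTransportedTorus g g' hgg' hg'g hgΩ) w₀ (ν w₀)) :
    ArchBallGrowth ((PlaneData.mixedRow q (a 0) (a 2)).withTransportedTorus g g' hgg' hg'g hgΩ) μinf :=
  archBallGrowth_of_slice _ w₀
    (hcpt_mixedRow_of_hdef q (a 0) (a 2) g g' hgg' hg'g hgΩ w₀ fun w' hw' => ⟨hreal w' hw', hcm w', hdef w' hw'⟩)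
    μinf ν hslice

/-- **The same from (7a)'s binders**: the sign clause on the OTHER row plane `(a 1, a 3)` and the seesaw isometry
`g B(a 1, a 3) gᵀ = λ B(a 0, a 2)`, `λ ≠ 0`. -/
theorem archBallGrowth_withTransportedTorus_of_iso_of_slice (lam : k) (hlam : lam ≠ 0)
    (hiso : g * (PlaneData.mixedRow q (a 1) (a 3)).B * gᵀ = lam • (PlaneData.mixedRow q (a 0) (a 2)).B)
    (w₀ : InfinitePlace k)
    (hreal : ∀ w : InfinitePlace k, w ≠ w₀ → w.IsReal) (hcm : ∀ w : InfinitePlace k, IsCMAt q w)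
    (hdef : ∀ w' : InfinitePlace k, w' ≠ w₀ →
      0 < (adToC w' (algebraMap k (Ad k) (a 1))).re * (adToC w' (algebraMap k (Ad k) (-1 * a 3))).re)
    (μinf : Measure (infinitePart ((PlaneData.mixedRow q (a 0) (a 2)).withTransportedTorus g g' hgg' hg'g hgΩ)))
    [μinf.IsHaarMeasure]
    (ν : ∀ w : InfinitePlace k,
      Measure (atPlace ((PlaneData.mixedRow q (a 0) (a 2)).withTransportedTorus g g' hgg' hg'g hgΩ) w))
    [∀ w, (ν w).IsHaarMeasure]
    (hslice : SliceBallGrowth ((PlaneData.mixedRow q (a 0) (a 2)).withTransportedTorus g g' hgg' hg'g hgΩ) w₀ (ν w₀)) :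
    ArchBallGrowth ((PlaneData.mixedRow q (a 0) (a 2)).withTransportedTorus g g' hgg' hg'g hgΩ) μinf :=
  archBallGrowth_of_slice _ w₀
    (hcpt_withTransportedTorus_of_iso q a g g' hgg' hg'g hgΩ lam hlam hiso w₀ hreal hcm hdef) μinf ν hslice

end General

/-! ## Part B — the seesaw instance over `k = E⁺ = ↥(maximalRealSubfield E)`, `w₀ = InfinitePlace.mk φ` -/

section Seesaw

variable {E : Type} [Field E] [NumberField E]

/-- **THE (8) INSTANCE AT THE SEESAW PLANE** (plan-4 g6 S15640): over `k = E⁺`, at `w₀ = InfinitePlace.mk φ`, from `hcm`, the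
sign clause on the plane's own lines `a 0`, `a 2` off `w₀`, and the slice ball growth at `w₀`, `ArchBallGrowth` holds for every
Haar `μinf` on `G_∞` of `seesawPlane … = (mixedRow q (a 0) (a 2)).withTransportedTorus g g' hgg' hg'g hgΩ`. -/
theorem archBallGrowth_seesaw_of_hdef_of_slice (q : QuadData ↥(maximalRealSubfield E))
    (a : Fin 4 → ↥(maximalRealSubfield E)) (φ : ↥(maximalRealSubfield E) →+* ℂ)
    (g g' : Matrix (Fin 4) (Fin 4) ↥(maximalRealSubfield E)) (hgg' : g * g' = 1) (hg'g : g' * g = 1)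
    (hgΩ : g * (PlaneData.mixedRow q (a 0) (a 2)).Ω = (PlaneData.mixedRow q (a 0) (a 2)).Ω * g)
    [MeasurableSpace (GA ((PlaneData.mixedRow q (a 0) (a 2)).withTransportedTorus g g' hgg' hg'g hgΩ))]
    [BorelSpace (GA ((PlaneData.mixedRow q (a 0) (a 2)).withTransportedTorus g g' hgg' hg'g hgΩ))]
    (hcm : ∀ w : InfinitePlace ↥(maximalRealSubfield E), IsCMAt q w)
    (hdef : ∀ w' : InfinitePlace ↥(maximalRealSubfield E), w' ≠ InfinitePlace.mk φ →
      0 < (adToC w' (algebraMap _ (Ad ↥(maximalRealSubfield E)) (a 0))).re *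
        (adToC w' (algebraMap _ (Ad ↥(maximalRealSubfield E)) (-1 * a 2))).re)
    (μinf : Measure (infinitePart ((PlaneData.mixedRow q (a 0) (a 2)).withTransportedTorus g g' hgg' hg'g hgΩ)))
    [μinf.IsHaarMeasure]
    (ν : ∀ w : InfinitePlace ↥(maximalRealSubfield E),
      Measure (atPlace ((PlaneData.mixedRow q (a 0) (a 2)).withTransportedTorus g g' hgg' hg'g hgΩ) w))
    [∀ w, (ν w).IsHaarMeasure]
    (hslice : SliceBallGrowth ((PlaneData.mixedRow q (a 0) (a 2)).withTransportedTorus g g' hgg' hg'g hgΩ)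
      (InfinitePlace.mk φ) (ν (InfinitePlace.mk φ))) :
    ArchBallGrowth ((PlaneData.mixedRow q (a 0) (a 2)).withTransportedTorus g g' hgg' hg'g hgΩ) μinf :=
  archBallGrowth_withTransportedTorus_of_hdef_of_slice q a g g' hgg' hg'g hgΩ (InfinitePlace.mk φ)
    (fun w _ => IsTotallyReal.isReal w) hcm hdef μinf ν hslice

/-- **THE (8) INSTANCE FROM (7a)'s BINDERS** (ArchMatchingSeesaw p709235's `lam`, `_hlam`, `_hiso`, `hcm`, `hdef` verbatim):
the sign clause on `(a 1, a 3)` off `w₀` and the seesaw isometry give the slice compactness of the seesaw plane, hence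
`ArchBallGrowth` from the slice bound at `w₀` — display (8) consumes no sign clause beyond (7a)'s. -/
theorem archBallGrowth_seesaw_of_iso_of_slice (q : QuadData ↥(maximalRealSubfield E))
    (a : Fin 4 → ↥(maximalRealSubfield E)) (φ : ↥(maximalRealSubfield E) →+* ℂ)
    (g g' : Matrix (Fin 4) (Fin 4) ↥(maximalRealSubfield E)) (hgg' : g * g' = 1) (hg'g : g' * g = 1)
    (hgΩ : g * (PlaneData.mixedRow q (a 0) (a 2)).Ω = (PlaneData.mixedRow q (a 0) (a 2)).Ω * g)
    (lam : ↥(maximalRealSubfield E)) (_hlam : lam ≠ 0)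
    (_hiso : g * (PlaneData.mixedRow q (a 1) (a 3)).B * gᵀ = lam • (PlaneData.mixedRow q (a 0) (a 2)).B)
    [MeasurableSpace (GA ((PlaneData.mixedRow q (a 0) (a 2)).withTransportedTorus g g' hgg' hg'g hgΩ))]
    [BorelSpace (GA ((PlaneData.mixedRow q (a 0) (a 2)).withTransportedTorus g g' hgg' hg'g hgΩ))]
    (hcm : ∀ w : InfinitePlace ↥(maximalRealSubfield E), IsCMAt q w)
    (hdef : ∀ w' : InfinitePlace ↥(maximalRealSubfield E), w' ≠ InfinitePlace.mk φ →
      0 < (adToC w' (algebraMap _ (Ad ↥(maximalRealSubfield E)) (a 1))).re *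
        (adToC w' (algebraMap _ (Ad ↥(maximalRealSubfield E)) (-1 * a 3))).re)
    (μinf : Measure (infinitePart ((PlaneData.mixedRow q (a 0) (a 2)).withTransportedTorus g g' hgg' hg'g hgΩ)))
    [μinf.IsHaarMeasure]
    (ν : ∀ w : InfinitePlace ↥(maximalRealSubfield E),
      Measure (atPlace ((PlaneData.mixedRow q (a 0) (a 2)).withTransportedTorus g g' hgg' hg'g hgΩ) w))
    [∀ w, (ν w).IsHaarMeasure]
    (hslice : SliceBallGrowth ((PlaneData.mixedRow q (a 0) (a 2)).withTransportedTorus g g' hgg' hg'g hgΩ)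
      (InfinitePlace.mk φ) (ν (InfinitePlace.mk φ))) :
    ArchBallGrowth ((PlaneData.mixedRow q (a 0) (a 2)).withTransportedTorus g g' hgg' hg'g hgΩ) μinf :=
  archBallGrowth_withTransportedTorus_of_iso_of_slice q a g g' hgg' hg'g hgΩ lam _hlam _hiso (InfinitePlace.mk φ)
    (fun w _ => IsTotallyReal.isReal w) hcm hdef μinf ν hslice

end Seesaw

end Summit.Ventures.HodgeRepro.Tier4.Line4

end
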